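import Summits.Ventures.PercRepro.RankLevelSetLevelSixT10Cell7
import Summits.Ventures.PercRepro.RankLevelSetLevelSixT10Cell8
import Summits.Ventures.PercRepro.RankLevelSetLevelSixT10Cell9
import Summits.Ventures.PercRepro.RankLevelSetLevelSixT10Cell10
import Summits.Ventures.PercRepro.RankLevelSetLevelSixT10Cell11
import Summits.Ventures.PercRepro.RankLevelSetLevelSixT10Cell12
import Summits.Ventures.PercRepro.RankLevelSetLevelSixT10Cell13
import Summits.Ventures.PercRepro.RankLevelSetLevelSixT10Cell14
import Summits.Ventures.PercRepro.RankLevelSetLevelSixT10Cell15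
import Summits.Ventures.PercRepro.RankLevelSetLevelSixT10Cell16
import Summits.Ventures.PercRepro.RankLevelSetLevelSixT10Cell17
import Summits.Ventures.PercRepro.RankLevelSetLevelSixT10Cell18
import Summits.Ventures.PercRepro.RankLevelSetLevelSixT10Cell19
import Summits.Ventures.PercRepro.RankLevelSetLevelSixT10Cell20
import Summits.Ventures.PercRepro.RankLevelSetLevelSixT10Cell21
import Summits.Ventures.PercRepro.RankLevelSetLevelSixT10Cell22
import Summits.Ventures.PercRepro.RankLevelSetLevelSixT10Cell23
import Summits.Ventures.PercRepro.RankLevelSetLevelSixT10Cell24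
import Summits.Ventures.PercRepro.RankLevelSetLevelSixT10Cell25
import Summits.Ventures.PercRepro.RankLevelSetLevelSixT10Cell26
import Summits.Ventures.PercRepro.RankLevelSetLevelSixT10Cell27
import Summits.Ventures.PercRepro.RankLevelSetLevelSixT10Cell28
import Summits.Ventures.PercRepro.RankLevelSetLevelSixT10Cell29
import Summits.Ventures.PercRepro.RankLevelSetLevelSixT10Cell30
import Summits.Ventures.PercRepro.RankLevelSetLevelSixT10Cell31
import Summits.Ventures.PercRepro.RankLevelSetLevelSixT10Cell32
import Summits.Ventures.PercRepro.RankLevelSetLevelSixT10Cell33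
import Summits.Ventures.PercRepro.RankLevelSetLevelSixT10Cell34
import Summits.Ventures.PercRepro.S3MidKeyTen
import Summits.Ventures.PercRepro.S3SixWindow
import Summits.Ventures.PercRepro.RankLevelSetLevelFiveLadder

/-!
# PercRepro — THE 10 ROW'S CORE: `c025_core_six_ten (d ≥ 7) : RLS M 10 6` — EVERY `e`-FREE CORE OF RANK `10` AT LEVEL `6`, AND THE
ROW 10 GIVEN THE ROW 11 (p7 g22, S3 feeder; p8's assembly shape; tools/gen_rowP.py)

The core cells `(10, d)`: `7 ≤ d ≤ 34` by the coloop device with the lossy ladder on the natural cells of the rows `10 − k`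
(`c025_core_six_ten_<d>`), `d ≥ 35` by the middle key (`S3Mid.c025_core_six_midkey_ten`, no coloop-freeness needed). Then the
level-5 glue `rls_six_at_of_core 10` on `c025_five_all` (level `5` at `p = 9`) gives level `6` at `p = 10`; with the 11 row
this is the 10 row: **`c025_six_large_ten_of_eleven`**.
Axioms: standard.
-/

open scoped Matroid

namespace PercRepro

namespace ThmN

variable {α : Type}

/-- **The core cell `(10, d)` at every corank `d ≥ 7`, every `e`-free core.** -/
theorem c025_core_six_ten (M : Matroid α) [M.Finite] (d : ℕ) (hd7 : 7 ≤ d)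
    (hR : M.eRank = (10 : ℕ∞)) (hn : M.E.ncard = 10 + d)
    (hfree : ∀ e ∈ M.E, ∃ A ⊆ M.E \ {e}, e ∉ M.closure A ∧ e ∉ M.closure ((M.E \ {e}) \ A)) :
    RLS M 10 6 := by
  rcases Nat.lt_or_ge d 35 with hlt | hge
  · interval_cases d
    · exact c025_core_six_ten_7 M hR hn hfree
    · exact c025_core_six_ten_8 M hR hn hfree
    · exact c025_core_six_ten_9 M hR hn hfree
    · exact c025_core_six_ten_10 M hR hn hfree
    · exact c025_core_six_ten_11 M hR hn hfree
    · exact c025_core_six_ten_12 M hR hn hfree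
    · exact c025_core_six_ten_13 M hR hn hfree
    · exact c025_core_six_ten_14 M hR hn hfree
    · exact c025_core_six_ten_15 M hR hn hfree
    · exact c025_core_six_ten_16 M hR hn hfree
    · exact c025_core_six_ten_17 M hR hn hfree
    · exact c025_core_six_ten_18 M hR hn hfree
    · exact c025_core_six_ten_19 M hR hn hfree
    · exact c025_core_six_ten_20 M hR hn hfree
    · exact c025_core_six_ten_21 M hR hn hfree
    · exact c025_core_six_ten_22 M hR hn hfree
    · exact c025_core_six_ten_23 M hR hn hfree
    · exact c025_core_six_ten_24 M hR hn hfree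
    · exact c025_core_six_ten_25 M hR hn hfree
    · exact c025_core_six_ten_26 M hR hn hfree
    · exact c025_core_six_ten_27 M hR hn hfree
    · exact c025_core_six_ten_28 M hR hn hfree
    · exact c025_core_six_ten_29 M hR hn hfree
    · exact c025_core_six_ten_30 M hR hn hfree
    · exact c025_core_six_ten_31 M hR hn hfree
    · exact c025_core_six_ten_32 M hR hn hfree
    · exact c025_core_six_ten_33 M hR hn hfree
    · exact c025_core_six_ten_34 M hR hn hfree
  · exact S3Mid.c025_core_six_midkey_ten M d hge hR hn hfree

/-- **THEOREM C₆ AT RANK `10`**: level `6` at `p = 10` for every finite matroid (on level `5` at `p = 9`, `c025_five_all`). -/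
theorem c025_six_at_ten (M : Matroid α) [M.Finite] : RLS M 10 6 :=
  rls_six_at_of_core 10 (by norm_num) (fun M _ => c025_five_all M 9 (by norm_num))
    (fun M _ d hd hR hn hfree => c025_core_six_ten M d hd hR hn hfree) M

/-- **THE 10 ROW GIVEN THE 11 ROW**: C-025 at level `6` for every `p ≥ 10`, every finite matroid, from the 11 row. -/
theorem c025_six_large_ten_of_eleven (h : ∀ (M : Matroid α) [M.Finite] (p : ℕ), 11 ≤ p → RLS M p 6)
    (M : Matroid α) [M.Finite] (p : ℕ) (hp : 10 ≤ p) : RLS M p 6 := by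
  rcases Nat.lt_or_ge p 11 with hlt | hge
  · have hP : p = 10 := by omega
    subst hP
    exact c025_six_at_ten M
  · exact h M p hge

end ThmN

end PercRepro
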